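import Summits.AtomisticToContinuum.FouriersLaw.Theorems.PhononMeanFreePathDefs
import Summits.AtomisticToContinuum.FouriersLaw.Theorems.PhononMeanFreePathBoundaryKubo
import Summits.AtomisticToContinuum.FouriersLaw.Theorems.PhononMeanFreePathIncoherentBoundedReductions
import Summits.AtomisticToContinuum.FouriersLaw.Theorems.PhononMeanFreePathIncoherentBoundedCurrentKubo

/-!
# `PhononMeanFreePath.IncoherentBounded` — its exact logical position, now that `BoundaryKubo` is a theorem

Helper file for item `stmt-AtomisticToContinuum-11815` (support `IncoherentBounded`, route `PhononMeanFreePath`,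
sub-problem `FouriersLaw`). Notation (route Defs): for the `(N+1)`-site pinned anharmonic chain `pinnedChain ω₂ lam β γ`
with both baths at `T`, `μ₀ = gibbsMeasure (N+1) T`, `K_t = transitionKernel (N+1) T T t`,
`C_N = powerCov` (`Cov_{μ₀}(p_0², K_t p_N²)`), `r_N = pairCorr` (`⟨p_0, K_t p_N⟩_{μ₀}`),
`G_N := (γ²/T²)∫₀^∞ C_N` (the equilibrium Green–Kubo conductance, `0 ≤ G_N ≤ γ/2` for all `N`:
`conductance_nonneg`, `conductance_le_half`), `a_N := N(γ²/T²)∫₀^∞(C_N - 2r_N²)` (the item's sequence).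

Since 2026-08-16 the sibling items `NessUnique` (stmt-0741, `NessUnique_holds`) and `BoundaryKubo` (stmt-11812,
`boundaryKubo_proof`) are THEOREMS. Discharging them in the reductions of `…IncoherentBoundedReductions`:

* `boundedResponse_iff_kuboBounded`, `boundedResponse_iff_conductanceBounded` — UNCONDITIONALLY, the catalogued
  waypoint `BoundedResponse` (stmt-11071 = `HasBoundedResponse (pinnedChain …)`) is the statement
  `∀ parameters > 0, ∀ T > 0, sup_N N·G_N < ∞` about the constructed equilibrium kernels (no steady-state family,
  no `δ`-limit left in it): the finite-size conductance of the pinned anharmonic chain is `O(1/N)`.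
* `kubo_eq_seq_add_coherent` — `N·G_N = a_N + 2(γ²/T²)·(N∫₀^∞ r_N²)` with BOTH summands of unknown size but the
  second `≥ 0`; hence `seq_le_kubo` (`a_N ≤ N·G_N`) and `seq_bddAbove_of_boundedResponse`: the waypoint gives the
  upper half of the item for free.
* `incoherentBounded_iff_boundedResponse_of_coherentBounded` — under mere BOUNDEDNESS of the coherent (Landauer)
  channel, `sup_N N∫₀^∞ r_N² < ∞` (weaker than the crux `CoherentDephasing`, which asks `N∫r_N² → 0`), the item IS the
  waypoint; `incoherentBounded_iff_boundedResponse'` — the same under `CoherentDephasing` alone (prover-0's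
  three-hypothesis equivalence with two hypotheses discharged).
* `boundedResponse_iff_coherentBounded_of_incoherentBounded` — conversely, GIVEN the item, the waypoint is exactly
  boundedness of the coherent channel (false at the harmonic corner, `HarmonicCoherentPersistence`).

So the three boundedness statements { item `IncoherentBounded`, waypoint `BoundedResponse`, coherent boundedness }
are such that any two imply the third, and the waypoint alone already gives `a_N ≤ B`. What the item adds to the
waypoint is the LOWER bound `-B ≤ a_N`, i.e. `2(γ²/T²)N∫r_N² ≤ N·G_N + B` (the coherent channel does not exceed the
total conductance by more than `O(1/N)`). No definitions; nothing here closes an item.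
-/

noncomputable section

open MeasureTheory Set Filter Topology
open scoped NNReal

namespace Summit.AtomisticToContinuum.FouriersLaw.Theorems.IncoherentBounded

open Literature.MathematicalPhysics.KineticTheory.HeatConduction
open Summit.AtomisticToContinuum.FouriersLaw.Theses.PhononMeanFreePath
open Summit.AtomisticToContinuum.FouriersLaw.Theorems.PhononMeanFreePath (powerCov pairCorr fcast)
open Summit.AtomisticToContinuum.FouriersLaw.Theorems.PhononMeanFreePathBoundaryKubo (boundaryKubo_proof)

/-! ## 1. The waypoint `BoundedResponse` is `sup_N N·G_N < ∞`, unconditionally -/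

/-- A steady-state family of the pinned anharmonic chain exists (choice on the proved existence fact
`pinnedChain_exists_isSteadyState`; junk `0` off the positive temperature quadrant). [folklore] -/
theorem exists_steadyFamily {ω₂ lam β γ : ℝ} (hω : 0 < ω₂) (hl : 0 < lam) (hβ : 0 < β) (hγ : 0 < γ) :
    ∃ μ : (N : ℕ) → ℝ → ℝ → Measure (PhaseSpace N), ∀ (N : ℕ) (T_L T_R : ℝ), 0 < T_L → 0 < T_R →
      (pinnedChain ω₂ lam β γ).IsSteadyState N T_L T_R (μ N T_L T_R) := by
  classical
  refine ⟨fun N T_L T_R => if h : 0 < T_L ∧ 0 < T_R then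
      Classical.choose (pinnedChain_exists_isSteadyState hω hl hβ hγ N h.1 h.2) else 0, ?_⟩
  intro N T_L T_R hL hR
  simp only [dif_pos (And.intro hL hR)]
  exact Classical.choose_spec (pinnedChain_exists_isSteadyState hω hl hβ hγ N hL hR)

/-- **`BoundedResponse ↔ sup_N |N·G_N| < ∞` at every parameter point (UNCONDITIONAL).** (→): along the canonical
steady-state family the response coefficients exist with `D₀ = 0`, `D_{N+1} = N·G_N` (`boundaryKubo_proof` over
`NessUnique_holds`), and the waypoint bounds them. (←): along ANY steady-state family the coefficients, when they
exist, are these numbers (uniqueness of limits on `𝓝[≠] 0`). [cite: BonettoLebowitzReyBellet2000, §6.3 (arXiv p. 12)] -/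
theorem boundedResponse_iff_kuboBounded :
    BoundedResponse ↔ ∀ ω₂ lam β γ : ℝ, 0 < ω₂ → 0 < lam → 0 < β → 0 < γ → ∀ T : ℝ, 0 < T →
      ∃ B : ℝ, ∀ N : ℕ, |(N : ℝ) * (γ ^ 2 / T ^ 2) * ∫ t in Ioi (0 : ℝ), powerCov ω₂ lam β γ T N t| ≤ B := by
  constructor
  · intro hR ω₂ lam β γ hω hl hβ hγ T hT
    obtain ⟨μ, hμ⟩ := exists_steadyFamily hω hl hβ hγ
    have hKT := boundaryKubo_proof ω₂ lam β γ hω hl hβ hγ (NessUnique_holds ω₂ lam β γ hω hl hβ hγ) μ hμ T hT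
    -- the response coefficients along `μ`: `D 0 = 0`, `D (N+1) = N (γ²/T²) ∫ C_N`
    let D : ℕ → ℝ := fun M =>
      ((M - 1 : ℕ) : ℝ) * (γ ^ 2 / T ^ 2) * ∫ t in Ioi (0 : ℝ), powerCov ω₂ lam β γ T (M - 1) t
    have hD : ∀ M : ℕ, Tendsto (fun δ : ℝ =>
        (pinnedChain ω₂ lam β γ).totalCurrent (μ M (T + δ / 2) (T - δ / 2)) / δ) (𝓝[≠] 0) (𝓝 (D M)) := by
      intro M
      cases M with
      | zero =>
        have h0 : D 0 = 0 := by simp [D]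
        rw [h0]
        simp only [OscillatorChain.totalCurrent_zero, zero_div]
        exact tendsto_const_nhds
      | succ N =>
        have hN : D (N + 1) = (N : ℝ) * (γ ^ 2 / T ^ 2) * ∫ t in Ioi (0 : ℝ), powerCov ω₂ lam β γ T N t := by
          simp [D]
        rw [hN]
        exact (hKT N).2
    obtain ⟨B, hB⟩ := hR ω₂ lam β γ hω hl hβ hγ μ hμ T hT D hD
    refine ⟨B, fun N => ?_⟩
    have h := hB ⟨N + 1, rfl⟩
    simpa [D] using h
  · intro hK ω₂ lam β γ hω hl hβ hγ μ hμ T hT D hD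
    have hKT := boundaryKubo_proof ω₂ lam β γ hω hl hβ hγ (NessUnique_holds ω₂ lam β γ hω hl hβ hγ) μ hμ T hT
    obtain ⟨B, hB⟩ := hK ω₂ lam β γ hω hl hβ hγ T hT
    have hDK : ∀ N : ℕ, D (N + 1) = (N : ℝ) * (γ ^ 2 / T ^ 2) * ∫ t in Ioi (0 : ℝ), powerCov ω₂ lam β γ T N t :=
      fun N => tendsto_nhds_unique (hD (N + 1)) (hKT N).2
    have hD0 : D 0 = 0 := by
      have h0 := hD 0
      simp only [OscillatorChain.totalCurrent_zero, zero_div] at h0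
      exact tendsto_nhds_unique h0 tendsto_const_nhds
    refine ⟨max 0 B, ?_⟩
    rintro _ ⟨M, rfl⟩
    cases M with
    | zero => simp [hD0]
    | succ N =>
      refine le_max_of_le_right ?_
      show |D (N + 1)| ≤ B
      rw [hDK N]
      exact hB N

section Parameters

variable {ω₂ lam β γ : ℝ} (hω : 0 < ω₂) (hl : 0 < lam) (hβ : 0 < β) (hγ : 0 < γ) {T : ℝ} (hT : 0 < T)
include hω hl hβ hγ hT

/-- `0 ≤ N·G_N` for every `N` (Green–Kubo positivity of the total current, `conductance_nonneg`).
[cite: KunduDharNarayan2009, arXiv:0809.4543 p. 3] -/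
theorem kubo_nonneg (N : ℕ) :
    0 ≤ (N : ℝ) * (γ ^ 2 / T ^ 2) * ∫ t in Ioi (0 : ℝ), powerCov ω₂ lam β γ T N t := by
  rw [mul_assoc]
  exact mul_nonneg (Nat.cast_nonneg N) (conductance_nonneg hω hl.le hβ hγ hT N)

omit hω hl hβ hγ hT in
/-- `0 ≤ N ∫₀^∞ r_N²` (integral of a square). [folklore] -/
theorem coherent_nonneg (N : ℕ) :
    0 ≤ (N : ℝ) * ∫ t in Ioi (0 : ℝ), (pairCorr ω₂ lam β γ T N t) ^ 2 :=
  mul_nonneg (Nat.cast_nonneg N) (setIntegral_nonneg measurableSet_Ioi fun _ _ => sq_nonneg _)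

/-- **Two-channel bookkeeping of the conductance**: `N·G_N = a_N + 2(γ²/T²)·(N∫₀^∞ r_N²)` at every `N`
(both `C_N` and `r_N²` are integrable at fixed `N`, `seq_eq_sub`). [folklore] -/
theorem kubo_eq_seq_add_coherent (N : ℕ) :
    (N : ℝ) * (γ ^ 2 / T ^ 2) * ∫ t in Ioi (0 : ℝ), powerCov ω₂ lam β γ T N t =
      (N : ℝ) * (γ ^ 2 / T ^ 2) * (∫ t in Ioi (0 : ℝ),
          (powerCov ω₂ lam β γ T N t - 2 * (pairCorr ω₂ lam β γ T N t) ^ 2)) +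
        2 * (γ ^ 2 / T ^ 2) * ((N : ℝ) * ∫ t in Ioi (0 : ℝ), (pairCorr ω₂ lam β γ T N t) ^ 2) := by
  have h := seq_eq_sub hω hl.le hβ hγ hT N
  simp only [powerCov, pairCorr, fcast]
  linarith [h]

/-- **`a_N ≤ N·G_N` for every `N`** (the coherent channel is non-negative). [folklore] -/
theorem seq_le_kubo (N : ℕ) :
    (N : ℝ) * (γ ^ 2 / T ^ 2) * (∫ t in Ioi (0 : ℝ),
        (powerCov ω₂ lam β γ T N t - 2 * (pairCorr ω₂ lam β γ T N t) ^ 2)) ≤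
      (N : ℝ) * (γ ^ 2 / T ^ 2) * ∫ t in Ioi (0 : ℝ), powerCov ω₂ lam β γ T N t := by
  have h := kubo_eq_seq_add_coherent hω hl hβ hγ hT N
  have h2 := coherent_nonneg (ω₂ := ω₂) (lam := lam) (β := β) (γ := γ) (T := T) N
  have hg : 0 ≤ 2 * (γ ^ 2 / T ^ 2) := by positivity
  nlinarith [mul_nonneg hg h2]

end Parameters

/-- The item in the route vocabulary (definitional unfolding of `powerCov`, `pairCorr`, `fcast`). [folklore] -/
theorem incoherentBounded_iff_seqBounded :
    IncoherentBounded ↔ ∀ ω₂ lam β γ : ℝ, 0 < ω₂ → 0 < lam → 0 < β → 0 < γ → ∀ T : ℝ, 0 < T →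
      ∃ B : ℝ, ∀ N : ℕ, |(N : ℝ) * (γ ^ 2 / T ^ 2) * ∫ t in Ioi (0 : ℝ),
        (powerCov ω₂ lam β γ T N t - 2 * (pairCorr ω₂ lam β γ T N t) ^ 2)| ≤ B := by
  simp only [IncoherentBounded, powerCov, pairCorr, fcast]

/-- **`BoundedResponse ↔ sup_N N·G_N < ∞`, signed form** (`N·G_N ≥ 0` by Green–Kubo positivity): the catalogued
waypoint says exactly that the finite-size equilibrium conductance of the pinned anharmonic chain is `O(1/N)`.
[cite: BonettoLebowitzReyBellet2000, §6.3 (arXiv p. 12)] -/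
theorem boundedResponse_iff_conductanceBounded :
    BoundedResponse ↔ ∀ ω₂ lam β γ : ℝ, 0 < ω₂ → 0 < lam → 0 < β → 0 < γ → ∀ T : ℝ, 0 < T →
      ∃ B : ℝ, ∀ N : ℕ, (N : ℝ) * (γ ^ 2 / T ^ 2) * ∫ t in Ioi (0 : ℝ), powerCov ω₂ lam β γ T N t ≤ B := by
  rw [boundedResponse_iff_kuboBounded]
  constructor
  · intro h ω₂ lam β γ hω hl hβ hγ T hT
    obtain ⟨B, hB⟩ := h ω₂ lam β γ hω hl hβ hγ T hT
    exact ⟨B, fun N => (le_abs_self _).trans (hB N)⟩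
  · intro h ω₂ lam β γ hω hl hβ hγ T hT
    obtain ⟨B, hB⟩ := h ω₂ lam β γ hω hl hβ hγ T hT
    refine ⟨B, fun N => ?_⟩
    rw [abs_of_nonneg (kubo_nonneg hω hl hβ hγ hT N)]
    exact hB N

/-! ## 2. The upper half of the item follows from the waypoint -/

/-- **`BoundedResponse` gives `a_N ≤ B`** (upper half of `IncoherentBounded`, unconditionally):
`a_N ≤ N·G_N ≤ B`. [folklore] -/
theorem seq_bddAbove_of_boundedResponse (hR : BoundedResponse) :
    ∀ ω₂ lam β γ : ℝ, 0 < ω₂ → 0 < lam → 0 < β → 0 < γ → ∀ T : ℝ, 0 < T →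
      ∃ B : ℝ, ∀ N : ℕ, (N : ℝ) * (γ ^ 2 / T ^ 2) * (∫ t in Ioi (0 : ℝ),
        (powerCov ω₂ lam β γ T N t - 2 * (pairCorr ω₂ lam β γ T N t) ^ 2)) ≤ B := by
  intro ω₂ lam β γ hω hl hβ hγ T hT
  obtain ⟨B, hB⟩ := (boundedResponse_iff_conductanceBounded.1 hR) ω₂ lam β γ hω hl hβ hγ T hT
  exact ⟨B, fun N => (seq_le_kubo hω hl hβ hγ hT N).trans (hB N)⟩

/-! ## 3. Any two of { item, waypoint, coherent boundedness } give the third -/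

/-- **Coherent channel bounded ⇒ (`IncoherentBounded ↔ BoundedResponse`).** With `0 ≤ N∫r_N² ≤ B_c`:
(→) `N·G_N = a_N + 2(γ²/T²)N∫r_N² ≤ B_a + 2(γ²/T²)B_c`; (←) `-2(γ²/T²)B_c ≤ a_N ≤ N·G_N ≤ B`.
The hypothesis is the boundedness half of the crux `CoherentDephasing` (which asks `N∫r_N² → 0`).
[cite: BonettoLebowitzReyBellet2000, §6.3 (arXiv p. 12)] -/
theorem incoherentBounded_iff_boundedResponse_of_coherentBounded
    (hcoh : ∀ ω₂ lam β γ : ℝ, 0 < ω₂ → 0 < lam → 0 < β → 0 < γ → ∀ T : ℝ, 0 < T →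
      ∃ B : ℝ, ∀ N : ℕ, (N : ℝ) * ∫ t in Ioi (0 : ℝ), (pairCorr ω₂ lam β γ T N t) ^ 2 ≤ B) :
    IncoherentBounded ↔ BoundedResponse := by
  rw [incoherentBounded_iff_seqBounded, boundedResponse_iff_conductanceBounded]
  constructor
  · intro h ω₂ lam β γ hω hl hβ hγ T hT
    obtain ⟨Ba, hBa⟩ := h ω₂ lam β γ hω hl hβ hγ T hT
    obtain ⟨Bc, hBc⟩ := hcoh ω₂ lam β γ hω hl hβ hγ T hT
    refine ⟨Ba + 2 * (γ ^ 2 / T ^ 2) * Bc, fun N => ?_⟩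
    have h1 := (le_abs_self _).trans (hBa N)
    have h2 := hBc N
    have hg : 0 ≤ 2 * (γ ^ 2 / T ^ 2) := by positivity
    rw [kubo_eq_seq_add_coherent hω hl hβ hγ hT N]
    nlinarith [mul_le_mul_of_nonneg_left h2 hg]
  · intro h ω₂ lam β γ hω hl hβ hγ T hT
    obtain ⟨Bk, hBk⟩ := h ω₂ lam β γ hω hl hβ hγ T hT
    obtain ⟨Bc, hBc⟩ := hcoh ω₂ lam β γ hω hl hβ hγ T hT
    refine ⟨max Bk (2 * (γ ^ 2 / T ^ 2) * Bc), fun N => ?_⟩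
    have hup := (seq_le_kubo hω hl hβ hγ hT N).trans (hBk N)
    have heq := kubo_eq_seq_add_coherent hω hl hβ hγ hT N
    have hk0 := kubo_nonneg hω hl hβ hγ hT N
    have hg : 0 ≤ 2 * (γ ^ 2 / T ^ 2) := by positivity
    have hc := mul_le_mul_of_nonneg_left (hBc N) hg
    rw [abs_le]
    constructor
    · have : -(2 * (γ ^ 2 / T ^ 2) * Bc) ≤ (N : ℝ) * (γ ^ 2 / T ^ 2) * (∫ t in Ioi (0 : ℝ),
          (powerCov ω₂ lam β γ T N t - 2 * (pairCorr ω₂ lam β γ T N t) ^ 2)) := by nlinarith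
      exact le_trans (neg_le_neg (le_max_right _ _)) this
    · exact hup.trans (le_max_left _ _)

/-- The crux `CoherentDephasing` implies boundedness of the coherent channel (a convergent sequence is bounded).
[folklore] -/
theorem coherentBounded_of_coherentDephasing (hA : CoherentDephasing) :
    ∀ ω₂ lam β γ : ℝ, 0 < ω₂ → 0 < lam → 0 < β → 0 < γ → ∀ T : ℝ, 0 < T →
      ∃ B : ℝ, ∀ N : ℕ, (N : ℝ) * ∫ t in Ioi (0 : ℝ), (pairCorr ω₂ lam β γ T N t) ^ 2 ≤ B := by
  intro ω₂ lam β γ hω hl hβ hγ T hT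
  obtain ⟨B, hB⟩ := exists_forall_abs_le_of_tendsto (hA ω₂ lam β γ hω hl hβ hγ T hT).2
  refine ⟨B, fun N => (le_abs_self _).trans ?_⟩
  simpa only [pairCorr, fcast] using hB N

/-- **`CoherentDephasing → (IncoherentBounded ↔ BoundedResponse)`** — prover-0's three-hypothesis equivalence
`incoherentBounded_iff_boundedResponse` with `NessUnique` and `BoundaryKubo` discharged by their proofs: modulo the
rank-2 crux alone, the item IS the catalogued waypoint `HasBoundedResponse (pinnedChain …)`.
[cite: BonettoLebowitzReyBellet2000, §6.3 (arXiv p. 12)] -/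
theorem incoherentBounded_iff_boundedResponse' (hA : CoherentDephasing) : IncoherentBounded ↔ BoundedResponse :=
  incoherentBounded_iff_boundedResponse NessUnique_holds boundaryKubo_proof hA

/-- **Given the item, the waypoint is exactly boundedness of the coherent channel**:
`IncoherentBounded → (BoundedResponse ↔ sup_N N∫₀^∞ r_N² < ∞)` at every parameter point
((→) `2(γ²/T²)N∫r_N² = N·G_N - a_N ≤ B_k + B_a`; (←) the previous equivalence). At the harmonic corner the
coherent channel is unbounded (`HarmonicCoherentPersistence`, `not_hasBoundedResponse`), and `a_N ≡ 0` there.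
[cite: RiederLebowitzLieb1967] -/
theorem boundedResponse_iff_coherentBounded_of_incoherentBounded (hI : IncoherentBounded) :
    BoundedResponse ↔ ∀ ω₂ lam β γ : ℝ, 0 < ω₂ → 0 < lam → 0 < β → 0 < γ → ∀ T : ℝ, 0 < T →
      ∃ B : ℝ, ∀ N : ℕ, (N : ℝ) * ∫ t in Ioi (0 : ℝ), (pairCorr ω₂ lam β γ T N t) ^ 2 ≤ B := by
  constructor
  · intro hR ω₂ lam β γ hω hl hβ hγ T hT
    obtain ⟨Bk, hBk⟩ := (boundedResponse_iff_conductanceBounded.1 hR) ω₂ lam β γ hω hl hβ hγ T hT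
    obtain ⟨Ba, hBa⟩ := (incoherentBounded_iff_seqBounded.1 hI) ω₂ lam β γ hω hl hβ hγ T hT
    have hg : 0 < 2 * (γ ^ 2 / T ^ 2) := by positivity
    refine ⟨(Bk + Ba) / (2 * (γ ^ 2 / T ^ 2)), fun N => ?_⟩
    rw [le_div_iff₀ hg]
    have heq := kubo_eq_seq_add_coherent hω hl hβ hγ hT N
    have h1 := hBk N
    have h2 := (neg_le_abs _).trans (hBa N)
    nlinarith
  · intro hcoh
    exact (incoherentBounded_iff_boundedResponse_of_coherentBounded hcoh).1 hI

end Summit.AtomisticToContinuum.FouriersLaw.Theorems.IncoherentBounded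

end
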